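import Summits.CriticalPhenomena.CardyFormulaZ2.Theorems.CardyUniqueLimitCardyRigidityFarFieldMoments

/-!
# Centered first moment of the stopped-modulus increment (line `crossing-martingale`, crux `CardyRigidity`)

Continuation of `…FarFieldMoments` (far-field MOMENT engine of stub `stub_kernelAffineCardy`,
crux `CardyRigidity`, stmt-CriticalPhenomena-0746): in the abstract setting of that file (sure bound
`|h n| ≤ C q/n`, `q = n^{3/4}`; good-event expansion `|h n - D n + S n X/n + P n X²/n²| ≤ C'(B³+B+1)/n³`
on `{B ≤ q/2}`; `S n → S₀`, `P n → P₀`, `n² D n → D₀`; `|X| ≤ B ∈ L³`):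

* `setIntegral_compl_good_dominator_le` — `∫_{B > K} B ≤ E[B³]/K²`;
* `tendsto_first_moment_of_centered` — if `E[X] = 0` then `n² E[h n] → D₀ - P₀ E[X²]`
  (the centering kills the `1/n` term: `n ∫_{B ≤ q/2} X = -n ∫_{B > q/2} X` and
  `n ∫_{B>q/2} B ≤ 4 n E[B³]/q² → 0`).
-/

noncomputable section

open MeasureTheory Filter Set Topology
open scoped NNReal ENNReal

namespace Summit.CriticalPhenomena.CardyFormulaZ2.Cruxes.CardyRigidity.CrossingMartingale

namespace FarField

section Moments

variable {Ω : Type*} {mΩ : MeasurableSpace Ω} {μ : Measure Ω} [IsProbabilityMeasure μ]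
  {X B : Ω → ℝ} {h : ℕ → Ω → ℝ} {S P D : ℕ → ℝ} {S₀ P₀ D₀ C C' : ℝ}

/-- On the complement of the good event, `B ≤ 4 B³/q²` (`B > q/2 > 0`); hence
`∫_{B > q/2} B ≤ 4 E[B³]/q²`. [folklore] -/
theorem setIntegral_compl_good_dominator_le (hBm : StronglyMeasurable B) (hB3 : MemLp B 3 μ)
    (hB0 : ∀ ω, 0 ≤ B ω) {K : ℝ} (hK : 0 < K) :
    ∫ ω in {ω | B ω ≤ K}ᶜ, B ω ∂μ ≤ (∫ ω, B ω ^ 3 ∂μ) / K ^ 2 := by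
  have hIB3 := integrable_cube_of_memLp_three hB3 hB0
  have hGm : MeasurableSet {ω | B ω ≤ K}ᶜ := (measurableSet_good hBm K).compl
  have hpt : ∀ ω ∈ {ω | B ω ≤ K}ᶜ, B ω ≤ B ω ^ 3 / K ^ 2 := by
    intro ω hω
    simp only [mem_compl_iff, mem_setOf_eq, not_le] at hω
    rw [le_div_iff₀ (pow_pos hK 2)]
    have hB := hB0 ω
    have : K ^ 2 ≤ B ω ^ 2 := pow_le_pow_left₀ hK.le hω.le 2
    nlinarith
  calc ∫ ω in {ω | B ω ≤ K}ᶜ, B ω ∂μ ≤ ∫ ω in {ω | B ω ≤ K}ᶜ, B ω ^ 3 / K ^ 2 ∂μ :=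
        setIntegral_mono_on (integrable_of_memLp_three hB3).integrableOn
          ((hIB3.div_const _).integrableOn) hGm hpt
    _ ≤ ∫ ω, B ω ^ 3 / K ^ 2 ∂μ :=
        setIntegral_le_integral (hIB3.div_const _)
          (Eventually.of_forall fun ω ↦ by have := hB0 ω; positivity)
    _ = (∫ ω, B ω ^ 3 ∂μ) / K ^ 2 := integral_div _ _

/-- **First moment, centered case.**  If `E[X] = 0` then `n² E[h n] → D₀ - P₀ E[X²]`.
[folklore] -/
theorem tendsto_first_moment_of_centered (hXm : Measurable X) (hBm : StronglyMeasurable B)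
    (hB3 : MemLp B 3 μ) (hB0 : ∀ ω, 0 ≤ B ω) (hXB : ∀ᵐ ω ∂μ, |X ω| ≤ B ω)
    (hhm : ∀ᶠ n : ℕ in atTop, Measurable (h n))
    (hsure : ∀ᶠ n : ℕ in atTop, ∀ ω, |h n ω| ≤ C * ((n : ℝ)) ^ (3 / 4 : ℝ) / n)
    (hgood : ∀ᶠ n : ℕ in atTop, ∀ᵐ ω ∂μ, B ω ≤ ((n : ℝ)) ^ (3 / 4 : ℝ) / 2 →
      |h n ω - D n + S n * (X ω / n) + P n * (X ω / n) ^ 2| ≤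
        C' * (B ω ^ 3 + B ω + 1) / (n : ℝ) ^ 3)
    (hS : Tendsto S atTop (𝓝 S₀)) (hP : Tendsto P atTop (𝓝 P₀))
    (hD : Tendsto (fun n : ℕ ↦ (n : ℝ) ^ 2 * D n) atTop (𝓝 D₀))
    (hX0 : ∫ ω, X ω ∂μ = 0) :
    Tendsto (fun n : ℕ ↦ (n : ℝ) ^ 2 * ∫ ω, h n ω ∂μ) atTop (𝓝 (D₀ - P₀ * ∫ ω, X ω ^ 2 ∂μ)) := by
  -- notation
  set q : ℕ → ℝ := fun n ↦ ((n : ℝ)) ^ (3 / 4 : ℝ) with hq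
  set G : ℕ → Set Ω := fun n ↦ {ω | B ω ≤ q n / 2} with hG
  have hGm : ∀ n, MeasurableSet (G n) := fun n ↦ measurableSet_good hBm _
  -- integrability
  have hIX : Integrable X μ := Integrable.mono' (integrable_of_memLp_three hB3)
    hXm.aestronglyMeasurable (by filter_upwards [hXB] with ω hω; rwa [Real.norm_eq_abs])
  have hIX2 : Integrable (fun ω ↦ X ω ^ 2) μ := by
    refine Integrable.mono' (integrable_sq_of_memLp_three hB3 hB0)
      (hXm.pow_const 2).aestronglyMeasurable ?_
    filter_upwards [hXB] with ω hω
    rw [Real.norm_eq_abs, abs_pow, sq_abs]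
    have := hB0 ω
    rw [abs_le] at hω
    nlinarith
  have hIB := integrable_of_memLp_three hB3
  have hIB3 := integrable_cube_of_memLp_three hB3 hB0
  set EB3 : ℝ := ∫ ω, B ω ^ 3 ∂μ with hEB3
  set Emom : ℝ := ∫ ω, (B ω ^ 3 + B ω + 1) ∂μ with hEmom
  have hImom : Integrable (fun ω ↦ B ω ^ 3 + B ω + 1) μ := (hIB3.add hIB).add (integrable_const _)
  have hEB3nn : 0 ≤ EB3 := integral_nonneg fun ω ↦ pow_nonneg (hB0 ω) 3
  -- the five terms
  set U₁ : ℕ → ℝ := fun n ↦ (n : ℝ) ^ 2 * D n * μ.real (G n) with hU₁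
  set U₂ : ℕ → ℝ := fun n ↦ -(S n * ((n : ℝ) * ∫ ω in G n, X ω ∂μ)) with hU₂
  set U₃ : ℕ → ℝ := fun n ↦ -(P n * ∫ ω in G n, X ω ^ 2 ∂μ) with hU₃
  set ρ : ℕ → Ω → ℝ := fun n ω ↦ h n ω - D n + S n * (X ω / n) + P n * (X ω / n) ^ 2 with hρ
  set U₄ : ℕ → ℝ := fun n ↦ (n : ℝ) ^ 2 * ∫ ω in G n, ρ n ω ∂μ with hU₄
  set U₅ : ℕ → ℝ := fun n ↦ (n : ℝ) ^ 2 * ∫ ω in (G n)ᶜ, h n ω ∂μ with hU₅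
  -- the decomposition, eventually
  have hdecomp : ∀ᶠ n : ℕ in atTop,
      (n : ℝ) ^ 2 * ∫ ω, h n ω ∂μ = U₁ n + U₂ n + U₃ n + U₄ n + U₅ n := by
    filter_upwards [hhm, hsure, eventually_gt_atTop 0] with n hmn hsn hn0
    have hnpos : (0 : ℝ) < n := by exact_mod_cast hn0
    have hIh : Integrable (h n) μ := integrable_of_abs_le hmn (hsn)
    rw [← integral_add_compl (hGm n) hIh]
    have hsplit : ∫ ω in G n, h n ω ∂μ = D n * μ.real (G n) - S n / n * ∫ ω in G n, X ω ∂μ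
        - P n / (n : ℝ) ^ 2 * ∫ ω in G n, X ω ^ 2 ∂μ + ∫ ω in G n, ρ n ω ∂μ := by
      have hIρ : Integrable (ρ n) μ := by
        simp only [hρ]
        refine ((hIh.sub (integrable_const _)).add ((hIX.div_const _).const_mul _)).add ?_
        have : (fun ω ↦ P n * (X ω / n) ^ 2) = fun ω ↦ P n / (n : ℝ) ^ 2 * X ω ^ 2 := by
          funext ω; ring
        rw [this]; exact hIX2.const_mul _
      have hfun : (fun ω ↦ h n ω) = fun ω ↦
          (D n - S n / n * X ω - P n / (n : ℝ) ^ 2 * X ω ^ 2) + ρ n ω := by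
        funext ω; simp only [hρ]; ring
      rw [hfun, integral_add _ hIρ.integrableOn]
      · rw [integral_sub, integral_sub, integral_const_mul, integral_const_mul]
        · simp only [setIntegral_const, smul_eq_mul, mul_comm (μ.real (G n))]
        · exact (integrable_const _).integrableOn
        · exact (hIX.const_mul _).integrableOn
        · exact ((integrable_const _).sub (hIX.const_mul _)).integrableOn
        · exact (hIX2.const_mul _).integrableOn
      · exact (((integrable_const _).sub (hIX.const_mul _)).sub (hIX2.const_mul _)).integrableOn
    rw [hsplit]
    simp only [hU₁, hU₂, hU₃, hU₄, hU₅]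
    field_simp
    ring
  -- limits of the five terms
  have hL₁ : Tendsto U₁ atTop (𝓝 D₀) := by
    have := hD.mul (tendsto_measureReal_good (μ := μ) hBm monotone_scale_half tendsto_scale_half_atTop)
    simpa [hU₁] using this
  have hL₂ : Tendsto U₂ atTop (𝓝 0) := by
    -- `∫_G X = -∫_{Gᶜ} X` and `|n ∫_{Gᶜ} X| ≤ 4 n E[B³]/q²`
    have h0 : Tendsto (fun n : ℕ ↦ |S n| * (16 * EB3 * ((n : ℝ) / (q n) ^ 2))) atTop (𝓝 0) := by
      have := hS.abs.mul (tendsto_div_scale_sq.const_mul (16 * EB3))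
      simpa using this
    rw [← neg_zero]
    refine Tendsto.neg ?_
    refine squeeze_zero_norm' (a := fun n : ℕ ↦ |S n| * (16 * EB3 * ((n : ℝ) / (q n) ^ 2))) ?_ h0
    filter_upwards [eventually_gt_atTop 0] with n hn0
    have hnpos : (0 : ℝ) < n := by exact_mod_cast hn0
    have hqpos : 0 < q n := Real.rpow_pos_of_pos hnpos _
    rw [Real.norm_eq_abs, abs_mul]
    refine mul_le_mul_of_nonneg_left ?_ (abs_nonneg _)
    -- `∫_G X = -∫_{Gᶜ} X`
    have hcompl : ∫ ω in G n, X ω ∂μ = -∫ ω in (G n)ᶜ, X ω ∂μ := by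
      have := integral_add_compl (hGm n) hIX
      rw [hX0] at this
      linarith
    rw [hcompl, mul_neg, abs_neg, abs_mul, abs_of_pos hnpos]
    have h1 : |∫ ω in (G n)ᶜ, X ω ∂μ| ≤ ∫ ω in (G n)ᶜ, B ω ∂μ := by
      rw [← Real.norm_eq_abs]
      refine (norm_integral_le_integral_norm _).trans ?_
      refine setIntegral_mono_ae hIX.norm.integrableOn hIB.integrableOn ?_
      filter_upwards [hXB] with ω hω
      rwa [Real.norm_eq_abs]
    have h2 : ∫ ω in (G n)ᶜ, B ω ∂μ ≤ EB3 / (q n / 2) ^ 2 :=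
      setIntegral_compl_good_dominator_le hBm hB3 hB0 (by positivity)
    calc (n : ℝ) * |∫ ω in (G n)ᶜ, X ω ∂μ| ≤ (n : ℝ) * (EB3 / (q n / 2) ^ 2) :=
          mul_le_mul_of_nonneg_left (h1.trans h2) hnpos.le
      _ = 4 * EB3 * ((n : ℝ) / (q n) ^ 2) := by field_simp; ring
      _ ≤ 16 * EB3 * ((n : ℝ) / (q n) ^ 2) := by
          have : 0 ≤ (n : ℝ) / (q n) ^ 2 := by positivity
          nlinarith
  have hL₃ : Tendsto U₃ atTop (𝓝 (-(P₀ * ∫ ω, X ω ^ 2 ∂μ))) :=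
    (hP.mul (tendsto_setIntegral_good hBm monotone_scale_half tendsto_scale_half_atTop hIX2)).neg
  have hL₄ : Tendsto U₄ atTop (𝓝 0) := by
    have h0 : Tendsto (fun n : ℕ ↦ |C'| * Emom * ((n : ℝ))⁻¹) atTop (𝓝 0) := by
      have := tendsto_inv_natCast.const_mul (|C'| * Emom)
      simpa using this
    refine squeeze_zero_norm' (a := fun n : ℕ ↦ |C'| * Emom * ((n : ℝ))⁻¹) ?_ h0
    filter_upwards [hgood, eventually_gt_atTop 0] with n hgn hn0
    have hnpos : (0 : ℝ) < n := by exact_mod_cast hn0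
    rw [Real.norm_eq_abs, hU₄]
    simp only
    have hbound : ∀ᵐ ω ∂μ.restrict (G n), ‖ρ n ω‖ ≤ C' * (B ω ^ 3 + B ω + 1) / (n : ℝ) ^ 3 := by
      rw [ae_restrict_iff' (hGm n)]
      filter_upwards [hgn] with ω hω hωG
      rw [Real.norm_eq_abs]
      exact hω hωG
    have hIg : Integrable (fun ω ↦ C' * (B ω ^ 3 + B ω + 1) / (n : ℝ) ^ 3) (μ.restrict (G n)) := by
      have : (fun ω ↦ C' * (B ω ^ 3 + B ω + 1) / (n : ℝ) ^ 3) =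
          fun ω ↦ C' / (n : ℝ) ^ 3 * (B ω ^ 3 + B ω + 1) := by funext ω; ring
      rw [this]; exact (hImom.const_mul _).integrableOn
    have h1 := norm_integral_le_of_norm_le hIg hbound
    rw [Real.norm_eq_abs] at h1
    have h2 : ∫ ω in G n, C' * (B ω ^ 3 + B ω + 1) / (n : ℝ) ^ 3 ∂μ ≤ |C'| * Emom / (n : ℝ) ^ 3 := by
      have hC' : ∀ ω, C' * (B ω ^ 3 + B ω + 1) / (n : ℝ) ^ 3 ≤ |C'| / (n : ℝ) ^ 3 * (B ω ^ 3 + B ω + 1) := by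
        intro ω
        have hm : 0 ≤ B ω ^ 3 + B ω + 1 := by have := hB0 ω; positivity
        rw [mul_div_right_comm]
        exact mul_le_mul_of_nonneg_right (div_le_div_of_nonneg_right (le_abs_self _) (by positivity)) hm
      calc ∫ ω in G n, C' * (B ω ^ 3 + B ω + 1) / (n : ℝ) ^ 3 ∂μ
          ≤ ∫ ω in G n, |C'| / (n : ℝ) ^ 3 * (B ω ^ 3 + B ω + 1) ∂μ :=
            setIntegral_mono_on hIg ((hImom.const_mul _).integrableOn) (hGm n) (fun ω _ ↦ hC' ω)
        _ ≤ ∫ ω, |C'| / (n : ℝ) ^ 3 * (B ω ^ 3 + B ω + 1) ∂μ :=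
            setIntegral_le_integral (hImom.const_mul _)
              (Eventually.of_forall fun ω ↦ by have := hB0 ω; positivity)
        _ = |C'| * Emom / (n : ℝ) ^ 3 := by rw [integral_const_mul]; ring
    calc |(n : ℝ) ^ 2 * ∫ ω in G n, ρ n ω ∂μ| = (n : ℝ) ^ 2 * |∫ ω in G n, ρ n ω ∂μ| := by
          rw [abs_mul, abs_of_pos (by positivity)]
      _ ≤ (n : ℝ) ^ 2 * (|C'| * Emom / (n : ℝ) ^ 3) :=
          mul_le_mul_of_nonneg_left (h1.trans h2) (by positivity)
      _ = |C'| * Emom * ((n : ℝ))⁻¹ := by field_simp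
  have hL₅ : Tendsto U₅ atTop (𝓝 0) := by
    have h0 : Tendsto (fun n : ℕ ↦ 8 * |C| * EB3 * ((n : ℝ) / (q n) ^ 2)) atTop (𝓝 0) := by
      have := tendsto_div_scale_sq.const_mul (8 * |C| * EB3)
      simpa using this
    refine squeeze_zero_norm' (a := fun n : ℕ ↦ 8 * |C| * EB3 * ((n : ℝ) / (q n) ^ 2)) ?_ h0
    filter_upwards [hhm, hsure, eventually_gt_atTop 0] with n hmn hsn hn0
    have hnpos : (0 : ℝ) < n := by exact_mod_cast hn0
    have hqpos : 0 < q n := Real.rpow_pos_of_pos hnpos _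
    rw [Real.norm_eq_abs, hU₅]
    simp only
    have h1 : ‖∫ ω in (G n)ᶜ, h n ω ∂μ‖ ≤ |C| * q n / n * μ.real (G n)ᶜ := by
      refine norm_setIntegral_le_of_norm_le_const (measure_lt_top _ _) fun ω _ ↦ ?_
      rw [Real.norm_eq_abs]
      refine (hsn ω).trans ?_
      gcongr
      exact le_abs_self C
    have h2 : μ.real (G n)ᶜ ≤ EB3 / (q n / 2) ^ 3 := measureReal_compl_good_le hB3 hB0 (by positivity)
    rw [Real.norm_eq_abs] at h1
    calc |(n : ℝ) ^ 2 * ∫ ω in (G n)ᶜ, h n ω ∂μ| = (n : ℝ) ^ 2 * |∫ ω in (G n)ᶜ, h n ω ∂μ| := by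
          rw [abs_mul, abs_of_pos (by positivity)]
      _ ≤ (n : ℝ) ^ 2 * (|C| * q n / n * (EB3 / (q n / 2) ^ 3)) := by
          apply mul_le_mul_of_nonneg_left _ (by positivity)
          exact h1.trans (mul_le_mul_of_nonneg_left h2 (by positivity))
      _ = 8 * |C| * EB3 * ((n : ℝ) / (q n) ^ 2) := by field_simp; ring
  have hsum : Tendsto (fun n ↦ U₁ n + U₂ n + U₃ n + U₄ n + U₅ n) atTop
      (𝓝 (D₀ + 0 + -(P₀ * ∫ ω, X ω ^ 2 ∂μ) + 0 + 0)) :=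
    (((hL₁.add hL₂).add hL₃).add hL₄).add hL₅
  have : D₀ + 0 + -(P₀ * ∫ ω, X ω ^ 2 ∂μ) + 0 + 0 = D₀ - P₀ * ∫ ω, X ω ^ 2 ∂μ := by ring
  rw [this] at hsum
  exact hsum.congr' (hdecomp.mono fun n hn ↦ hn.symm)

end Moments

/-- **Registered form** (glue sub-goal `farField_tendsto_first_moment_of_centered` of
stmt-CriticalPhenomena-0746): centered first moment of the stopped-modulus increment,
`E[X] = 0 ⇒ n² E[h n] → D₀ - P₀ E[X²]`. [folklore] -/
theorem farField_tendsto_first_moment_of_centered : ∀ {Ω : Type*} {mΩ : MeasurableSpace Ω} {μ : MeasureTheory.Measure Ω} [MeasureTheory.IsProbabilityMeasure μ] {X B : Ω → ℝ} {h : ℕ → Ω → ℝ} {S P D : ℕ → ℝ} {S₀ P₀ D₀ C C' : ℝ}, Measurable X → MeasureTheory.StronglyMeasurable B → MeasureTheory.MemLp B 3 μ → (∀ ω, 0 ≤ B ω) → (∀ᵐ ω ∂μ, |X ω| ≤ B ω) → (∀ᶠ n : ℕ in Filter.atTop, Measurable (h n)) → (∀ᶠ n : ℕ in Filter.atTop,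 ∀ ω, |h n ω| ≤ C * ((n : ℝ)) ^ (3 / 4 : ℝ) / n) → (∀ᶠ n : ℕ in Filter.atTop, ∀ᵐ ω ∂μ, B ω ≤ ((n : ℝ)) ^ (3 / 4 : ℝ) / 2 → |h n ω - D n + S n * (X ω / n) + P n * (X ω / n) ^ 2| ≤ C' * (B ω ^ 3 + B ω + 1) / (n : ℝ) ^ 3) → Filter.Tendsto S Filter.atTop (nhds S₀) → Filter.Tendsto P Filter.atTop (nhds P₀) → Filter.Tendsto (fun n : ℕ ↦ (n : ℝ) ^ 2 * D n) Filter.atTop (nhds D₀) → ∫ ω, X ω ∂μ = 0 → Filter.Tendsto (fun n : ℕ ↦ (n : ℝ) ^ 2 * ∫ ω, h n ω ∂μ) Filter.atTop (nhds (D₀ - P₀ * ∫ ω, X ω ^ 2 ∂μ)) :=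
  fun hXm hBm hB3 hB0 hXB hhm hsure hgood hS hP hD hX0 ↦
    tendsto_first_moment_of_centered hXm hBm hB3 hB0 hXB hhm hsure hgood hS hP hD hX0

end FarField

end Summit.CriticalPhenomena.CardyFormulaZ2.Cruxes.CardyRigidity.CrossingMartingale

end
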